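import Mathlib
import Summits.NavierStokesRegularity.NavierStokesRegularity.Theorems.TypeIQuarterGateScarEnvelopeTypeISatelliteTowerRigidRootCensus

/-!
# Satellite tower for crux `ScarEnvelopeTypeI` (stmt-NavierStokesRegularity-23843) — Part U8–U12: THE THIRD MINIMISATION — the KNSS envelope constant `A_*(I)`

Part U8–U12 of nsreg-p3's ROUND-40 artefact (section `EnvelopeConst`): `envFamily I`, `minEnv I = A_*(I)` (inf of unit-window KNSS envelope
constants over the doubly-minimal family), `levelCrit_le_minEnv` (`A_*(I) ≥ M_c(I)`), ★ `minEnv_attained`, `TriplyMin I n`, `triplyMin_nonempty`,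
★ `TriplyMin.saturated` (the optimal constant is `A_*(I)` on EVERY sub-window), ★ `TriplyMin.blowup_root` (class, energy AND envelope constant
conserved under root blow-up), `exists_triplyMin_leaf`, `triplyMin_or_wild_of_not_scarEnvelopeTypeI`, `scarEnvelopeTypeI_of_noTriplyMin_noRigidRootDescent`.

PROVENANCE: declaration texts VERBATIM from the HOME artefact of the instrument seat nsreg-p3 g27 (cell `pub/ns-regularity-ideate`):
`round-40/Root40.lean` (sha16 `d3d4255074edfeef`, NEW part `partU.lean`; a standalone module written against the TREE;
memo `round-40/ROUND-40.md` c4a2dbdad86380a6), scored PASS ★★ by referee ref3 g27 (`SCORE-p3-ROUND-40-0828.md` 41a324c979557729); the author cannot write under `Theorems/`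
(`perm.theorems-prover-only`); landed by the prover ns-es-p1 g5 as landing hand of record (director-ns DIRECTOR-NS #237 (3)), split into
≤ 400-line modules, `E3` spelled out, the artefact's `#guard_msgs … #print axioms` certificates not landed.
`--supports stmt-NavierStokesRegularity-23843 --as helper`.

HONEST FRAMING: instrument theorems about HYPOTHETICAL Type-I zoom limits (Albritton–Barker objects of the census of crux
`TypeIQuarterGate.ScarEnvelopeTypeI`, item 23843); the analytic input is the tree's closure engine (compactness
`local_typeI_compactness_twin_inBall`, sharpened to constant 1 in Part S1; Q1 whole-space), P1 rate inheritance, L8 persistence and the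
tree's PROVED small-constant Liouville theorem; Parts R/S are order theory on the re-classing and closure lemmas.  NOTHING OPEN IS
PROVED: 23843, (L′) `TypeILiouvilleAB` / (L′₀), the GLOBAL (S∞) = `CritAttained`, (M𝐈₁), (E1⁺), (E2ᵣ), route ExtremalTypeIConstant's
cruxes, N0 and Navier–Stokes regularity are OPEN; `critRate`, `levelCrit I`, `liouvilleRate` are `sInf`s that are `0` by junk value
when the defining set is empty (every statement using them carries the nonemptiness hypothesis explicitly).
-/

-- the summit-side namespace repeats a component by design (single-conjunct summit, D-0017)
set_option linter.dupNamespace false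

open MeasureTheory Set Metric Filter Topology
open scoped ENNReal NNReal InnerProductSpace
open Literature.Analysis.FluidPDE

namespace Summit.NavierStokesRegularity.NavierStokesRegularity.Cruxes.ScarEnvelopeTypeI.ZoomDictionary

section EnvelopeConst

variable {U : ℝ → (EuclideanSpace ℝ (Fin 3)) → (EuclideanSpace ℝ (Fin 3))} {P : ℝ → (EuclideanSpace ℝ (Fin 3)) → ℝ}

/-- The unit-window envelope constants realised in the doubly-minimal family of the level `I`. -/
def envFamily (I : ℝ≥0∞) : Set ℝ := {A | ∃ n : TNode, DoublyMin I n ∧ EnvNode A n}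

/-- **`A_*(I)`**, the MINIMAL ENVELOPE CONSTANT of the level (junk value `0` if no doubly-minimal object of
the level is tame; every statement below carries the tameness hypothesis where needed). -/
noncomputable def minEnv (I : ℝ≥0∞) : ℝ := sInf (envFamily I)

/-- `envFamily I` is bounded below (by `0`). -/
theorem envFamily_bddBelow (I : ℝ≥0∞) : BddBelow (envFamily I) :=
  ⟨0, fun _ ⟨_, _, hA⟩ => hA.nonneg one_pos⟩

/-- Every unit-window envelope constant of a doubly-minimal object is `≥ M_c(I)`. -/
theorem levelCrit_le_of_mem_envFamily {I : ℝ≥0∞} {A : ℝ} (hA : A ∈ envFamily I) : levelCrit I ≤ A := by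
  obtain ⟨n, hn, hAn⟩ := hA
  exact hn.1.levelCrit_le_of_locEnv one_pos hAn

/-- If the doubly-minimal family of level `I` has a tame member, `envFamily I` is nonempty. -/
theorem envFamily_nonempty {I : ℝ≥0∞} (htame : ∃ n : TNode, DoublyMin I n ∧ TameRoot n) :
    (envFamily I).Nonempty := by
  obtain ⟨n, hn, hb⟩ := htame
  obtain ⟨n', hD', -, -, -, ⟨A, hA⟩, -⟩ := hn.exists_tameLeaf hb
  exact ⟨A, n', hD', hA⟩

/-- ★★ **U8. EVERY LOCAL ENVELOPE CONSTANT OF EVERY DOUBLY-MINIMAL OBJECT IS `≥ A_*(I)`** — at ANY radius: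
by U4 it is a unit-window envelope constant of a root blow-up, which is again in the family. -/
theorem DoublyMin.minEnv_le_of_locEnv {I : ℝ≥0∞} {n : TNode} (h : DoublyMin I n) {A δ : ℝ} (hδ : 0 < δ)
    (henv : LocEnv A δ n) : minEnv I ≤ A := by
  obtain ⟨L, Ū, hŪ⟩ := exists_tangentU_of_towerObj (towerObj_of_abTower h.1.1.1) 0
  obtain ⟨n', hD', -, -, -, -, henv', -⟩ := h.blowup_root hŪ
  exact csInf_le (envFamily_bddBelow I) ⟨n', hD', henv' A δ hδ henv⟩

/-- U8b. `M_c(I) ≤ A_*(I)`: the minimal envelope constant is at least the exact scar rate. -/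
theorem levelCrit_le_minEnv {I : ℝ≥0∞} (htame : ∃ n : TNode, DoublyMin I n ∧ TameRoot n) :
    levelCrit I ≤ minEnv I :=
  le_csInf (envFamily_nonempty htame) fun _ hA => levelCrit_le_of_mem_envFamily hA

/-- ★★★ **U9. THE THIRD MINIMISATION IS ATTAINED.**  If some doubly-minimal object of a finite
scar-carrying level is tame, then some doubly-minimal object of the level is enveloped on the unit window
with the MINIMAL constant `A_*(I)` (a minimising sequence inside the family; T1 closure with the liminf
energy clause keeps the limit doubly-minimal; the envelopes pass to the `L³` limit a.e. along an a.e.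
convergent subsequence and then everywhere by smoothness). -/
theorem minEnv_attained {I : ℝ≥0∞} (hI : I < ⊤) (hne : (levelRates I).Nonempty)
    (htame : ∃ n : TNode, DoublyMin I n ∧ TameRoot n) :
    ∃ n : TNode, DoublyMin I n ∧ EnvNode (minEnv I) n := by
  obtain ⟨u, -, hu, huS⟩ := exists_seq_tendsto_sInf (envFamily_nonempty htame) (envFamily_bddBelow I)
  choose n hn hA using huS
  have hmin : minLevel I < ⊤ := lt_of_le_of_lt (minLevel_le_self hI hne) hI
  obtain ⟨U', P', H', σ, hσ, hAB', hI', -, hmem, hconv, hpers⟩ :=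
    abSeq_closed' hmin (fun k => (n k).U) (fun k => (n k).P) (fun k => (n k).H)
      (fun k => (hn k).1.1.1) (fun k => ((hn k).2).le) tendsto_const_nhds
  have h0 : ¬ RegPt U' 0 := hpers fun k => (hn k).1.1.2
  have hE' : ExactCrit I ⟨U', P', H', 0⟩ := ⟨⟨hAB', h0⟩, hI'.trans (minLevel_le_self hI hne)⟩
  have hD' : DoublyMin I ⟨U', P', H', 0⟩ := ⟨hE', le_antisymm hI' (minLevel_le hE')⟩
  refine ⟨⟨U', P', H', 0⟩, hD', envNode_of_ae_le hAB' ?_⟩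
  -- a.e. convergence on `Q_1(0)` along a further subsequence
  have hmeas : ∀ j, AEStronglyMeasurable (Function.uncurry (n (σ j)).U)
      (volume.restrict (parabolicCylinder 1 (0 : ℝ × (EuclideanSpace ℝ (Fin 3))))) := fun j =>
    ((hn (σ j)).1.1.1.2.1 1 one_pos).1.distributional.1.aestronglyMeasurable
  obtain ⟨ψ, hψ, hae⟩ := exists_subseq_tendsto_ae₃ hmeas (hmem 1 one_pos).aestronglyMeasurable
    (hconv 1 one_pos)
  have hlim : Tendsto (fun i => u (σ (ψ i))) atTop (𝓝 (minEnv I)) :=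
    hu.comp (hσ.tendsto_atTop.comp hψ.tendsto_atTop)
  filter_upwards [hae, ae_restrict_mem (isOpen_parabolicCylinder _ _).measurableSet] with z hz hzmem
  obtain ⟨ht, hx⟩ := mem_prod.1 hzmem
  have ht' : z.1 ∈ Ioo (-((1 : ℝ) ^ 2)) 0 := by simpa using ht
  have hx' : z.2 ∈ ball (0 : (EuclideanSpace ℝ (Fin 3))) 1 := by simpa using hx
  exact le_of_tendsto_of_tendsto' hz.norm (hlim.div_const _) fun i => hA (σ (ψ i)) z.1 ht' z.2 hx'

/-- A **TRIPLY-MINIMAL** object of the level `I`: doubly-minimal AND enveloped on the unit window with the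
minimal constant `A_*(I)`. -/
def TriplyMin (I : ℝ≥0∞) (n : TNode) : Prop := DoublyMin I n ∧ EnvNode (minEnv I) n

/-- The triply-minimal family of a finite scar-carrying level with a tame doubly-minimal member is nonempty (U9). -/
theorem triplyMin_nonempty {I : ℝ≥0∞} (hI : I < ⊤) (hne : (levelRates I).Nonempty)
    (htame : ∃ n : TNode, DoublyMin I n ∧ TameRoot n) : ∃ n : TNode, TriplyMin I n :=
  minEnv_attained hI hne htame

/-- A triply-minimal object is tame at the root. -/
theorem TriplyMin.tameRoot {I : ℝ≥0∞} {n : TNode} (h : TriplyMin I n) : TameRoot n :=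
  h.2.tameRoot h.1.1.1.1

/-- ★★★ **U10. SCALE SATURATION.**  On EVERY window `Q_δ(0)`, `0 < δ ≤ 1`, about the root of a triply-minimal
object the optimal envelope constant is EXACTLY `A_*(I)`: the envelope with constant `A_*(I)` holds there
(restriction), and NO smaller constant works at ANY radius (U8) — the KNSS weight `‖U‖·(‖x‖ + √(-t))` comes
arbitrarily close to its unit-window supremum `A_*(I)` inside every parabolic neighbourhood of the root scar. -/
theorem TriplyMin.saturated {I : ℝ≥0∞} {n : TNode} (h : TriplyMin I n) :
    (∀ δ : ℝ, 0 < δ → δ ≤ 1 → LocEnv (minEnv I) δ n) ∧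
      (∀ A δ : ℝ, 0 < δ → LocEnv A δ n → minEnv I ≤ A) ∧ levelCrit I ≤ minEnv I :=
  ⟨fun _ hδ hδ1 => h.2.mono hδ hδ1, fun _ _ hδ henv => h.1.minEnv_le_of_locEnv hδ henv,
    h.1.1.levelCrit_le_of_locEnv one_pos h.2⟩

/-- ★★ **U11. TRIPLY-MINIMAL OBJECTS REPRODUCE**: every root blow-up of a triply-minimal object is (a.e. on
the unit window) a triply-minimal object of the same level — a tame ONE-SCAR LEAF with root rated exactly
`M_c(I)`, the same energy, AND the same saturated envelope constant `A_*(I)` (U4 carries the unit-window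
envelope of the parent to the unit window of the child; U8 forbids anything smaller).  Class, energy and
envelope constant are ALL conserved by the renormalisation map. -/
theorem TriplyMin.blowup_root {I : ℝ≥0∞} {n : TNode} (h : TriplyMin I n)
    {L : ℕ → ℝ} {Ū : ℝ → (EuclideanSpace ℝ (Fin 3)) → (EuclideanSpace ℝ (Fin 3))} (hŪ : TangentU n.U n.P 0 0 L Ū) :
    ∃ n' : TNode, TriplyMin I n' ∧ n'.level = n.level ∧ n'.y = 0 ∧
      (∀ R ∈ Ioo (0 : ℝ) 1,
        ∀ᵐ z ∂(volume.restrict (parabolicCylinder R (0 : ℝ × (EuclideanSpace ℝ (Fin 3))))), Ū z.1 z.2 = n'.U z.1 z.2) ∧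
      LeafNode n' ∧ TameRoot n' ∧ tightRate n'.U 0 = levelCrit I := by
  obtain ⟨n', hD', hlev, hy', hid, hex, henv', htame⟩ := h.1.blowup_root hŪ
  exact ⟨n', ⟨hD', henv' _ 1 one_pos h.2⟩, hlev, hy', hid, (htame h.tameRoot).1, (htame h.tameRoot).2,
    hex⟩

/-- U11b. Hence a triply-minimal ONE-SCAR LEAF exists on the tame side. -/
theorem exists_triplyMin_leaf {I : ℝ≥0∞} (hI : I < ⊤) (hne : (levelRates I).Nonempty)
    (htame : ∃ n : TNode, DoublyMin I n ∧ TameRoot n) :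
    ∃ n : TNode, TriplyMin I n ∧ LeafNode n ∧ tightRate n.U 0 = levelCrit I := by
  obtain ⟨n, hn⟩ := triplyMin_nonempty hI hne htame
  obtain ⟨L, Ū, hŪ⟩ := exists_tangentU_of_towerObj (towerObj_of_abTower hn.1.1.1.1) 0
  obtain ⟨n', hT', -, -, -, hleaf, -, hex⟩ := hn.blowup_root hŪ
  exact ⟨n', hT', hleaf, hex⟩

/-- ★★★ **U12. THE TAME / WILD CENSUS WITH THE TRIPLY-MINIMAL ENEMY.**  If 23843 fails, then at the finite
energy level `I₀` of the violator (class `M_c(I₀) ∈ [ε_L, M]`): EITHER (TAME) there is a TRIPLY-MINIMAL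
ONE-SCAR LEAF — an A–B object of class `M_c(I₀)` with root scar rated exactly `M_c(I₀)`, no satellite in
the unit ball, minimal energy `minLevel I₀`, enveloped `‖U(t,x)‖ ≤ A_*(I₀)/(‖x‖ + √(-t))` on the unit window
with `A_*(I₀) ≥ M_c(I₀)` optimal ON EVERY SUB-WINDOW, whose root blow-ups are all again such —; OR (WILD)
no doubly-minimal object of the level is tame, each has root blow-ups with satellites at every radius in
`(0,1)`, there is a rigid root descent, and a wild one-scar doubly-minimal leaf or a rigid satellite
descent. -/
theorem triplyMin_or_wild_of_not_scarEnvelopeTypeI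
    (h : ¬ Summit.NavierStokesRegularity.NavierStokesRegularity.Theses.TypeIQuarterGate.ScarEnvelopeTypeI) :
    ∃ (M : ℝ) (I₀ : ℝ≥0∞), I₀ < ⊤ ∧ (levelRates I₀).Nonempty ∧ levelCrit I₀ ∈ Icc epsL M ∧
      minLevel I₀ ≤ I₀ ∧
      ((levelCrit I₀ ≤ minEnv I₀ ∧
          ∃ n : TNode, TriplyMin I₀ n ∧ LeafNode n ∧ tightRate n.U 0 = levelCrit I₀) ∨
        ((∀ n : TNode, DoublyMin I₀ n → ¬ TameRoot n) ∧ RigidRootDescent I₀ ∧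
          ((∃ n : TNode, DoublyMin I₀ n ∧ LeafNode n ∧ ¬ TameRoot n) ∨ RigidDescent I₀))) := by
  obtain ⟨M, I₀, hI₀, hne, hIcc, hmin, hcases⟩ := tame_or_wild_of_not_scarEnvelopeTypeI h
  refine ⟨M, I₀, hI₀, hne, hIcc, hmin, ?_⟩
  rcases hcases with ⟨n, A, hn, hb, -, -⟩ | hwild
  · exact Or.inl ⟨levelCrit_le_minEnv ⟨n, hn, hb⟩, exists_triplyMin_leaf hI₀ hne ⟨n, hn, hb⟩⟩
  · exact Or.inr hwild

/-- ★★ **U12b. 23843 FROM THE TRIPLY-MINIMAL EXCLUSION AND THE RIGID ROOT EXCLUSION.** -/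
theorem scarEnvelopeTypeI_of_noTriplyMin_noRigidRootDescent
    (hA : ∀ I : ℝ≥0∞, I < ⊤ → ∀ n : TNode, TriplyMin I n → ¬ LeafNode n)
    (hB : ∀ I : ℝ≥0∞, I < ⊤ → ¬ RigidRootDescent I) :
    Summit.NavierStokesRegularity.NavierStokesRegularity.Theses.TypeIQuarterGate.ScarEnvelopeTypeI := by
  by_contra h
  obtain ⟨M, I₀, hI₀, -, -, -, hcases⟩ := triplyMin_or_wild_of_not_scarEnvelopeTypeI h
  rcases hcases with ⟨-, n, hn, hl, -⟩ | ⟨-, hd, -⟩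
  · exact hA I₀ hI₀ n hn hl
  · exact hB I₀ hI₀ hd

end EnvelopeConst

end Summit.NavierStokesRegularity.NavierStokesRegularity.Cruxes.ScarEnvelopeTypeI.ZoomDictionary
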